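import Summits.BirchSwinnertonDyer.BirchSwinnertonDyer.Theorems.ByReductionTypeAtTwoTowerLayerTorsionLocal
import Summits.BirchSwinnertonDyer.BirchSwinnertonDyer.Theorems.ByReductionTypeAtTwoTowerLayerFrobenius
import Literature.NumberTheory.GaloisRepresentations.FrobeniusGeneration
import Literature.NumberTheory.EllipticCurves.ZpExtensionUnramifiedProofs
import Mathlib.NumberTheory.Padics.HeightOneSpectrum
import HarnessLib

/-!
# The layer-`j` torsion certificate at EVERY prime splitting completely in `ℚ_j`:
# `2^{j+3} ∣ ℓ² − 1` (i.e. `ℓ ≡ ±1 (mod 2^{j+2})`) ⇒ `#E[2^∞]^{Gal(ℚ̄/ℚ_j)} ≤ 2^{ord₂ #Ẽ(𝔽_ℓ)}`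
# (route ByReductionTypeAtTwo, items 19271 / 19573 / 19922, TOWER road; seat bsd-2adic-tower-1 GEN 5)

HONEST FRAMING (cell `bsd-2adic`, run/shared/lean/pub/bsd-2adic/, HUMAN RULINGS D-0036 / D-0054 / D-0074):
THEOREMS ONLY; nothing asserted; no definition; no new named fact; closes nothing by itself.

The landed certificates (`…TowerLayerTorsionLocal` §4, ord-2 GEN 6; `…TowerLayerTorsionCert` §3, this seat)
read the displayed binder `htor : #E[2^∞]^{Gal(ℚ̄/ℚ_j)} ≤ 2^t` of the torsion-tolerant tower doors off a
good prime `ℓ ≡ 1 (mod 2^{j+2})`: then `Γ_{ℚ_ℓ}` fixes `μ_{2^{j+2}}` and `ℚ(μ_{2^{j+2}}) ⊇ ℚ_j`. But the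
primes that split completely in the layer `ℚ_j = ℚ(ζ_{2^{j+2}})⁺` of the cyclotomic `ℤ₂`-extension are
exactly those with `ℓ ≡ ±1 (mod 2^{j+2})`, i.e. `2^{j+3} ∣ ℓ² − 1`, and the class `ℓ ≡ −1` matters for the
certified exponent `t`: a curve acquiring `2`-power torsion over `ℚ(ζ_{2^{j+2}}) ⊋ ℚ_j` (e.g. over `ℚ(i)`)
has `ord₂ #Ẽ(𝔽_ℓ) ≥ 2` at EVERY `ℓ ≡ 1 (mod 8)`, while primes `ℓ ≡ −1` can certify `t = 1` (seat census
2026-08-26: 317033c1, 290173e1 on the INELIG block; 181478c1 among mult-2's «neither» classes — its `(1,3)`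
pair closes only with `ℓ ≡ 7 (mod 8)`).

This file proves the certificate for all such `ℓ`, through the DECOMPOSITION GROUP instead of the roots of
unity:

* §1 `resGal_adicCompletion_mem_layerSubgroup_two` — for the cyclotomic `κ`, an odd place `v` of `ℚ` with
  rational prime `ℓ` and `2^{j+3} ∣ ℓ² − 1`: **`res(Γ_{ℚ_v}) ≤ Gal(ℚ̄/ℚ_j)`**. The image `res(Γ_{ℚ_v})` is
  the decomposition group `D_{𝔓₀}` of the prime `𝔓₀ ∣ v` cut out by the chosen embedding (tree
  `decompositionSubgroup_adicCompletionPrime_eq_range`); every `d ∈ D_{𝔓₀}` is `φⁿ·i·u` with `φ` an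
  arithmetic Frobenius, `i ∈ I_{𝔓₀}`, `u` in the open subgroup `Gal(ℚ̄/ℚ_j)` (tree
  `exists_eq_frobenius_pow_mul_of_mem_decompositionSubgroup`, Neukirch I (9.4)); `I_{𝔓₀} ≤ ker κ` (a
  `ℤ₂`-extension is unramified outside `2`, tree `ZpExtension.inertia_le_kerSubgroup_holds`, Washington
  Prop. 13.2); and `‖κ(φ)‖ = 2^{−(v₂(ℓ²−1)−3)}` (GEN 2's `norm_toAdd_apply_resGal_of_isAbsArithFrob_two`:
  `χ₂(Frob_ℓ) = ℓ`, `‖ℓog u‖ = 8‖u² − 1‖`), so `φ ∈ Gal(ℚ̄/ℚ_j) = κ⁻¹(2^j ℤ₂)` iff `j ≤ v₂(ℓ²−1) − 3`.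
* §2 `finite_and_card_torsion_baseChange_adicCompletion_dvd` — `#E(ℚ_v)_tors ∣ #Ẽ(𝔽_ℓ)` (finite): transport
  along Mathlib's `ℚ_v ≃ₐ[ℚ] ℚ_ℓ` (`Rat.HeightOneSpectrum.adicCompletion.padicEquiv`, an injective map on
  points) to ord-2's `card_torsion_baseChange_padic_dvd_reductionPointCount`.
* §3 **`natCard_fixedBy_layerSubgroup_le_pow_of_goodPrime_sq[_card]`** — the certificate: ord-2's §3
  (`natCard_fixedBy_le_natCard_fixedPoints_baseChange`, fixed points inject into `E_{ℚ_v}[2^∞]^{Γ_{ℚ_v}}`)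
  and §2 (`finite_and_natCard_fixedPoints_geomPrimaryTorsion_le_pow`, Galois descent over the perfect field
  `ℚ_v`) with §1–§2 above; `htor`-shaped wrappers `htor_layer_of_goodPrime_sq[_card]`.
* §4 the doors at a pair `(j, j')` in certificate currency with `2^{j+3} ∣ ℓ² − 1`:
  `TowerClass.towerGapAtTwo_of_counts_of_goodPrime_sq_card_layer` (strict Selmer lower count) and
  `TowerClass.towerGapAtTwo_of_classCounts_of_goodPrime_sq_card_layer` (`A`-currency lower count, KitE).

Relation to the sibling certificates: `…TowerLayerTorsionLocal` (ord-2) / `…TowerLayerTorsionCert` (this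
seat) = the case `ℓ ≡ 1 (mod 2^{j+2})` via roots of unity; `…TowerTorsionCertificateFrobenius` (ord-3 GEN 6,
`TowerLambdaTorsion.natCard_fixedBy_layerSubgroup_le_two_of_prime`) = the SHARP `t = 1` certificate from ONE
Frobenius at such an `ℓ` moving `√r`, `√s` (same membership `Frob_ℓ ∈ Gal(ℚ̄/ℚ_j) iff j + 3 ≤ v₂(ℓ² − 1)`);
this file = the point-count certificate for every `t`, through the WHOLE decomposition group.

References: [NeukirchANT1999] I §9 (9.4), II §9 (9.6); [Washington1997] §13.1, Prop. 13.2; [Serre1973] II §3.2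
Prop. 8; [SilvermanAEC2009] VII.3.1(b), VIII.§1; [GreenbergLNM1716] §1, §3 pp. 85–86, §4 Lemma 4.3.
-/

set_option autoImplicit false
-- the route's Theorems namespace repeats a component by design (summit = sub-problem, D-0017).
set_option linter.dupNamespace false

noncomputable section

open scoped Classical

open WeierstrassCurve Literature.NumberTheory.EllipticCurves Literature.NumberTheory.GaloisRepresentations
  Field NumberField IsDedekindDomain
open Literature.NumberTheory.GaloisRepresentations.IsNonarchimedeanLocalField

universe u

namespace Summit.BirchSwinnertonDyer.BirchSwinnertonDyer.Theorems.TowerLayer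

/-! ## §1 `res(Γ_{ℚ_v}) ≤ Gal(ℚ̄/ℚ_j)` for an odd prime `ℓ` with `2^{j+3} ∣ ℓ² − 1` -/

section Galois

/-- **An arithmetic Frobenius at an odd `ℓ` with `2^{j+3} ∣ ℓ² − 1` lies in `Gal(ℚ̄/ℚ_j)`**: for the
cyclotomic `ℤ₂`-extension `κ` and a local arithmetic Frobenius `τ₀ ∈ Γ_{ℚ_v}` (`v` the place of `ℓ`),
`‖κ(res τ₀)‖ = 2^{−(v₂(ℓ²−1)−3)} ≤ 2^{−j}`, i.e. `2^j ∣ κ(res τ₀)`. [cite: Washington1997, §13.1]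
[cite: Serre1973, Ch. II §3.2 Prop. 8] -/
theorem resGal_mem_layerSubgroup_two_of_isAbsArithFrob {κ : ZpExtension ℚ 2} (hκ : κ.IsCyclotomic)
    (v : HeightOneSpectrum (𝓞 ℚ)) (h2v : ((2 : ℕ) : 𝓞 ℚ) ∉ v.asIdeal) {j : ℕ}
    (hj : 2 ^ (j + 3) ∣ Rat.HeightOneSpectrum.natGenerator v ^ 2 - 1)
    {τ₀ : absoluteGaloisGroup (v.adicCompletion ℚ)} (hτ₀ : IsAbsArithFrob τ₀) :
    resGal (K := ℚ) (v.adicCompletion ℚ) τ₀ ∈ κ.layerSubgroup j := by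
  have hℓp : (Rat.HeightOneSpectrum.natGenerator v).Prime := Rat.HeightOneSpectrum.prime_natGenerator v
  have hN : Rat.HeightOneSpectrum.natGenerator v ^ 2 - 1 ≠ 0 := by
    have : 1 < Rat.HeightOneSpectrum.natGenerator v ^ 2 := by nlinarith [hℓp.one_lt]
    omega
  have hje : j + 3 ≤ padicValNat 2 (Rat.HeightOneSpectrum.natGenerator v ^ 2 - 1) :=
    (padicValNat_dvd_iff_le hN).mp hj
  have hnorm := norm_toAdd_apply_resGal_of_isAbsArithFrob_two hκ v h2v hτ₀
  rw [ZpExtension.mem_layerSubgroup, ← Ideal.mem_span_singleton, ← PadicInt.norm_le_pow_iff_mem_span_pow,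
    hnorm]
  exact zpow_le_zpow_right₀ (by norm_num) (by omega)

/-- **`res(Γ_{ℚ_v}) ≤ Gal(ℚ̄/ℚ_j)` when `2^{j+3} ∣ ℓ² − 1`** (`ℓ` the odd rational prime of `v`), for every
cyclotomic `ℤ₂`-extension `κ` of `ℚ`. The image of `res` is the decomposition group `D_{𝔓₀}` of the prime
above `v` cut out by the chosen embedding; its elements are `φⁿ·i·u` with `φ = res τ₀` an arithmetic
Frobenius (in `Gal(ℚ̄/ℚ_j)` by the previous theorem), `i ∈ I_{𝔓₀} ≤ ker κ` (`ℚ_∞/ℚ` is unramified at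
`ℓ ≠ 2`) and `u ∈ Gal(ℚ̄/ℚ_j)` (open). Equivalently: `ℓ ≡ ±1 (mod 2^{j+2})` splits completely in
`ℚ_j = ℚ(ζ_{2^{j+2}})⁺`. [cite: NeukirchANT1999, Ch. I §9 Prop. (9.4) and Ch. II §9 Prop. (9.6)]
[cite: Washington1997, §13.1 and Prop. 13.2] -/
theorem resGal_adicCompletion_mem_layerSubgroup_two {κ : ZpExtension ℚ 2} (hκ : κ.IsCyclotomic)
    (v : HeightOneSpectrum (𝓞 ℚ)) (h2v : ((2 : ℕ) : 𝓞 ℚ) ∉ v.asIdeal) {j : ℕ}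
    (hj : 2 ^ (j + 3) ∣ Rat.HeightOneSpectrum.natGenerator v ^ 2 - 1)
    (τ : absoluteGaloisGroup (v.adicCompletion ℚ)) :
    resGal (K := ℚ) (v.adicCompletion ℚ) τ ∈ κ.layerSubgroup j := by
  -- a local arithmetic Frobenius `τ₀`; `res τ₀` is an arithmetic Frobenius at `𝔓₀`
  obtain ⟨τ₀, hτ₀⟩ := exists_isAbsArithFrob_holds (F := v.adicCompletion ℚ)
  have hq : residueFieldCard (v.adicCompletion ℚ) = Nat.card (𝓞 ℚ ⧸ v.asIdeal) := by
    rw [Literature.NumberTheory.Automorphic.residueFieldCard_adicCompletion_eq,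
      HeightOneSpectrum.residueCard_eq_card_quotient]
  have hfrob := (isArithFrobAt_absGaloisRestrict_adicCompletionPrime_iff ℚ v hq τ₀).2 hτ₀
  have hφ : absGaloisRestrict ℚ (v.adicCompletion ℚ) τ₀ ∈ κ.layerSubgroup j :=
    resGal_mem_layerSubgroup_two_of_isAbsArithFrob hκ v h2v hj hτ₀
  -- `res τ ∈ D_{𝔓₀} = res(Γ_{ℚ_v})`, so `res τ = φⁿ · i · u`
  have hd : absGaloisRestrict ℚ (v.adicCompletion ℚ) τ ∈
      (adicCompletionPrime ℚ v).decompositionSubgroup (absoluteGaloisGroup ℚ) := by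
    rw [decompositionSubgroup_adicCompletionPrime_eq_range]
    exact ⟨τ, rfl⟩
  obtain ⟨n, i, u, hi, hu, hdec⟩ := exists_eq_frobenius_pow_mul_of_mem_decompositionSubgroup
    (adicCompletionPrime_mem_primesAbove ℚ v) hfrob (κ.isOpen_layerSubgroup j) hd
  have hi' : i ∈ κ.layerSubgroup j := κ.kerSubgroup_le_layerSubgroup j
    (ZpExtension.inertia_le_kerSubgroup_holds ℚ 2 κ h2v (adicCompletionPrime_mem_primesAbove ℚ v) hi)
  change absGaloisRestrict ℚ (v.adicCompletion ℚ) τ ∈ κ.layerSubgroup j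
  rw [hdec]
  exact mul_mem (mul_mem (pow_mem hφ n) hi') hu

/-- The hypothesis `((2 : ℕ) : 𝓞 ℚ) ∉ v` from `3 ≤ ℓ` (`ℓ` the rational prime of `v`). [folklore] -/
theorem two_not_mem_asIdeal_of_three_le (v : HeightOneSpectrum (𝓞 ℚ))
    (h3 : 3 ≤ Rat.HeightOneSpectrum.natGenerator v) : ((2 : ℕ) : 𝓞 ℚ) ∉ v.asIdeal := by
  intro h
  have hdvd := (Rat.natCast_mem_asIdeal_iff v).mp h
  have := Nat.le_of_dvd two_pos hdvd
  omega

end Galois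

/-! ## §2 `#E(ℚ_v)_tors ∣ #Ẽ(𝔽_ℓ)` — transport along `ℚ_v ≃ₐ[ℚ] ℚ_ℓ` -/

section Torsion

variable (W : WeierstrassCurve ℚ) [W.IsElliptic] [W.IsGloballyMinimal]

/-- **`E(ℚ_v)_tors` is finite and `#E(ℚ_v)_tors ∣ #Ẽ(𝔽_ℓ)`** at a good prime `ℓ ≥ 3` (`v` its place,
`ℚ_v = v.adicCompletion ℚ`): the continuous `ℚ`-algebra isomorphism `ℚ_v ≃ ℚ_ℓ` of Mathlib
(`Rat.HeightOneSpectrum.adicCompletion.padicEquiv`) induces an injective homomorphism on points, so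
`#E(ℚ_v)_tors ∣ #E(ℚ_ℓ)_tors ∣ #Ẽ(𝔽_ℓ)` (ord-2's `card_torsion_baseChange_padic_dvd_reductionPointCount`).
[cite: SilvermanAEC2009, VII.3 Prop. 3.1(b) and VII.2.1] -/
theorem finite_and_card_torsion_baseChange_adicCompletion_dvd (v : HeightOneSpectrum (𝓞 ℚ))
    [Fact (Rat.HeightOneSpectrum.natGenerator v).Prime] (h3 : 3 ≤ Rat.HeightOneSpectrum.natGenerator v)
    (hgood : W.HasGoodReductionAtPrime (Rat.HeightOneSpectrum.natGenerator v)) :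
    Finite (AddCommGroup.torsion (W.baseChange (v.adicCompletion ℚ)).toAffine.Point) ∧
      Nat.card (AddCommGroup.torsion (W.baseChange (v.adicCompletion ℚ)).toAffine.Point) ∣
        W.reductionPointCount (Rat.HeightOneSpectrum.natGenerator v) := by
  -- the injective homomorphism on points along `ℚ_v →ₐ[ℚ] ℚ_ℓ` (`ℓ = natGenerator v = ↑(primesEquiv v)`)
  let e : v.adicCompletion ℚ ≃ₐ[ℚ] ℚ_[Rat.HeightOneSpectrum.natGenerator v] :=
    (Rat.HeightOneSpectrum.adicCompletion.padicEquiv (R := 𝓞 ℚ) v).toAlgEquiv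
  let ι : (W.baseChange (v.adicCompletion ℚ)).toAffine.Point →+
      (W.baseChange ℚ_[Rat.HeightOneSpectrum.natGenerator v]).toAffine.Point :=
    Affine.Point.map (W' := W.toAffine) e.toAlgHom
  have hι : Function.Injective ι := Affine.Point.map_injective _
  have hle : AddCommGroup.torsion (W.baseChange (v.adicCompletion ℚ)).toAffine.Point ≤
      (AddCommGroup.torsion (W.baseChange ℚ_[Rat.HeightOneSpectrum.natGenerator v]).toAffine.Point).comap ι := by
    intro x hx
    rw [AddSubgroup.mem_comap, AddCommGroup.mem_torsion]
    exact ι.isOfFinAddOrder ((AddCommGroup.mem_torsion _).mp hx)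
  haveI hfin : Finite (AddCommGroup.torsion
      (W.baseChange ℚ_[Rat.HeightOneSpectrum.natGenerator v]).toAffine.Point) :=
    finite_torsion_baseChange_padic W _ h3 hgood
  have hd1 : Nat.card (AddCommGroup.torsion (W.baseChange (v.adicCompletion ℚ)).toAffine.Point) ∣
      Nat.card (AddCommGroup.torsion (W.baseChange ℚ_[Rat.HeightOneSpectrum.natGenerator v]).toAffine.Point) :=
    (AddSubgroup.card_dvd_of_le hle).trans (AddSubgroup.card_comap_dvd_of_injective _ ι hι)
  refine ⟨?_, hd1.trans (card_torsion_baseChange_padic_dvd_reductionPointCount W _ h3 hgood)⟩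
  haveI : Finite ((AddCommGroup.torsion
      (W.baseChange ℚ_[Rat.HeightOneSpectrum.natGenerator v]).toAffine.Point).comap ι) :=
    Finite.of_injective
      (fun x : (AddCommGroup.torsion
          (W.baseChange ℚ_[Rat.HeightOneSpectrum.natGenerator v]).toAffine.Point).comap ι ↦
        (⟨ι x, x.2⟩ : AddCommGroup.torsion
          (W.baseChange ℚ_[Rat.HeightOneSpectrum.natGenerator v]).toAffine.Point))
      (fun x y hxy ↦ Subtype.ext (hι (congrArg Subtype.val hxy)))
  exact Finite.of_injective _ (AddSubgroup.inclusion_injective hle)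

end Torsion

/-! ## §3 The layer-`j` torsion certificate at every `ℓ` with `2^{j+3} ∣ ℓ² − 1` -/

section Rat

variable (W : WeierstrassCurve ℚ) [W.IsElliptic] [W.IsGloballyMinimal]

/-- **THE LAYER-`j` TORSION CERTIFICATE AT A PRIME SPLITTING COMPLETELY IN `ℚ_j`.** For every cyclotomic
`ℤ₂`-extension `κ` of `ℚ`, a layer `j` and a good prime `ℓ ≥ 3` with `2^{j+3} ∣ ℓ² − 1` (i.e.
`ℓ ≡ ±1 (mod 2^{j+2})`): `#E[2^∞]^{Gal(ℚ̄/ℚ_j)} ≤ 2^{ord₂ #Ẽ(𝔽_ℓ)} ≤ 2^t`. Chain: `Gal(ℚ̄/ℚ_j) ≥ res(Γ_{ℚ_v})`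
(§1) ⇒ a layer-`j`-fixed `2`-power torsion point of `E(ℚ̄)` gives a `Γ_{ℚ_v}`-fixed one of `E(ℚ̄_v)`
(ord-2 `natCard_fixedBy_le_natCard_fixedPoints_baseChange`), i.e. a point of `E(ℚ_v)[2^∞]` (Galois descent,
ord-2 `finite_and_natCard_fixedPoints_geomPrimaryTorsion_le_pow`), and `#E(ℚ_v)_tors ∣ #Ẽ(𝔽_ℓ)` (§2).
[cite: SilvermanAEC2009, VII.3 Prop. 3.1(b), VIII.§1] [cite: Washington1997, §13.1 and Prop. 13.2]
[cite: NeukirchANT1999, Ch. I §9 Prop. (9.4)] -/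
theorem natCard_fixedBy_layerSubgroup_le_pow_of_goodPrime_sq {κ : ZpExtension ℚ 2} (hκ : κ.IsCyclotomic)
    (j ℓ : ℕ) [Fact ℓ.Prime] (h3 : 3 ≤ ℓ) (hgood : W.HasGoodReductionAtPrime ℓ)
    (hℓ1 : 2 ^ (j + 3) ∣ ℓ ^ 2 - 1) {t : ℕ} (hℓ : padicValNat 2 (W.reductionPointCount ℓ) ≤ t) :
    Nat.card {m : geomPrimaryTorsion W 2 | ∀ σ ∈ κ.layerSubgroup j, σ • m = m} ≤ 2 ^ t := by
  -- the place `v` of `ℓ`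
  obtain ⟨v, rfl⟩ : ∃ v : HeightOneSpectrum (𝓞 ℚ), Rat.HeightOneSpectrum.natGenerator v = ℓ :=
    ⟨(Rat.HeightOneSpectrum.primesEquiv (R := 𝓞 ℚ)).symm ⟨ℓ, Fact.out⟩,
      congrArg Subtype.val ((Rat.HeightOneSpectrum.primesEquiv (R := 𝓞 ℚ)).apply_symm_apply ⟨ℓ, Fact.out⟩)⟩
  have h2v : ((2 : ℕ) : 𝓞 ℚ) ∉ v.asIdeal := two_not_mem_asIdeal_of_three_le v h3
  -- `ℚ_v` is perfect (char. 0); `CharZero` is NOT registered as a local instance, lest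
  -- `DivisionRing.toRatAlgebra` replace the `ℚ`-algebra structure of `ℚ_v` in the terms below
  haveI : PerfectField (v.adicCompletion ℚ) := @PerfectField.ofCharZero _ _
    (charZero_of_injective_algebraMap (algebraMap ℚ (v.adicCompletion ℚ)).injective)
  obtain ⟨hfinT, hdvdT⟩ := finite_and_card_torsion_baseChange_adicCompletion_dvd W v h3 hgood
  -- (instances passed explicitly: the `CommRing ℚ_v` instance paths differ syntactically)
  obtain ⟨hfin, hle⟩ := @finite_and_natCard_fixedPoints_geomPrimaryTorsion_le_pow _ _ _
    (W.baseChange (v.adicCompletion ℚ)) 2 _ hfinT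
  have hN0 : W.reductionPointCount (Rat.HeightOneSpectrum.natGenerator v) ≠ 0 :=
    (W.reductionPointCount_pos _).ne'
  have hv : padicValNat 2 (Nat.card (AddCommGroup.torsion
      (W.baseChange (v.adicCompletion ℚ)).toAffine.Point)) ≤
      padicValNat 2 (W.reductionPointCount (Rat.HeightOneSpectrum.natGenerator v)) :=
    (padicValNat_dvd_iff_le hN0).mp (pow_padicValNat_dvd.trans hdvdT)
  calc Nat.card {m : geomPrimaryTorsion W 2 | ∀ σ ∈ κ.layerSubgroup j, σ • m = m}
      ≤ Nat.card (MulAction.fixedPoints (absoluteGaloisGroup (v.adicCompletion ℚ))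
          (geomPrimaryTorsion (W.baseChange (v.adicCompletion ℚ)) 2)) :=
        @natCard_fixedBy_le_natCard_fixedPoints_baseChange ℚ _ W (v.adicCompletion ℚ) _ _ 2
          (κ.layerSubgroup j) (resGal_adicCompletion_mem_layerSubgroup_two hκ v h2v hℓ1) hfin
    _ ≤ 2 ^ padicValNat 2 (Nat.card (AddCommGroup.torsion
          (W.baseChange (v.adicCompletion ℚ)).toAffine.Point)) := hle
    _ ≤ 2 ^ t := Nat.pow_le_pow_right two_pos (hv.trans hℓ)

/-- The same certificate from a DECIDABLE point count: `#Ẽ(𝔽_ℓ) = n`, `¬ 2^{t+1} ∣ n` (and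
`2^{j+3} ∣ ℓ² − 1` is itself decidable on the numerals). [cite: SilvermanAEC2009, VII.3 Prop. 3.1(b)] -/
theorem natCard_fixedBy_layerSubgroup_le_pow_of_goodPrime_sq_card {κ : ZpExtension ℚ 2}
    (hκ : κ.IsCyclotomic) (j ℓ : ℕ) [Fact ℓ.Prime] (h3 : 3 ≤ ℓ) (hgood : W.HasGoodReductionAtPrime ℓ)
    (hℓ1 : 2 ^ (j + 3) ∣ ℓ ^ 2 - 1) {t n : ℕ} (hn : W.reductionPointCount ℓ = n)
    (hndvd : ¬ 2 ^ (t + 1) ∣ n) :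
    Nat.card {m : geomPrimaryTorsion W 2 | ∀ σ ∈ κ.layerSubgroup j, σ • m = m} ≤ 2 ^ t := by
  have hn0 : n ≠ 0 := hn ▸ (W.reductionPointCount_pos ℓ).ne'
  exact natCard_fixedBy_layerSubgroup_le_pow_of_goodPrime_sq W hκ j ℓ h3 hgood hℓ1
    (hn ▸ TowerClass.padicValNat_le_of_not_pow_succ_dvd hn0 hndvd)

/-- The verbatim `htor` binder of the torsion-tolerant doors, all cyclotomic `κ` at once, from a good prime
`ℓ ≥ 3` with `2^{j+3} ∣ ℓ² − 1` and `ord₂ #Ẽ(𝔽_ℓ) ≤ t`. [cite: SilvermanAEC2009, VII.3 Prop. 3.1(b), VIII.§1]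
[cite: Washington1997, §13.1] -/
theorem htor_layer_of_goodPrime_sq (j ℓ : ℕ) [Fact ℓ.Prime] (h3 : 3 ≤ ℓ)
    (hgood : W.HasGoodReductionAtPrime ℓ) (hℓ1 : 2 ^ (j + 3) ∣ ℓ ^ 2 - 1) {t : ℕ}
    (hℓ : padicValNat 2 (W.reductionPointCount ℓ) ≤ t) :
    ∀ κ : ZpExtension ℚ 2, κ.IsCyclotomic →
      Nat.card {m : geomPrimaryTorsion W 2 | ∀ σ ∈ κ.layerSubgroup j, σ • m = m} ≤ 2 ^ t :=
  fun _ hκ ↦ natCard_fixedBy_layerSubgroup_le_pow_of_goodPrime_sq W hκ j ℓ h3 hgood hℓ1 hℓ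

/-- The verbatim `htor` binder, decidable reading (`#Ẽ(𝔽_ℓ) = n`, `¬ 2^{t+1} ∣ n`).
[cite: SilvermanAEC2009, VII.3 Prop. 3.1(b), VIII.§1] [cite: Washington1997, §13.1] -/
theorem htor_layer_of_goodPrime_sq_card (j ℓ : ℕ) [Fact ℓ.Prime] (h3 : 3 ≤ ℓ)
    (hgood : W.HasGoodReductionAtPrime ℓ) (hℓ1 : 2 ^ (j + 3) ∣ ℓ ^ 2 - 1) {t n : ℕ}
    (hn : W.reductionPointCount ℓ = n) (hndvd : ¬ 2 ^ (t + 1) ∣ n) :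
    ∀ κ : ZpExtension ℚ 2, κ.IsCyclotomic →
      Nat.card {m : geomPrimaryTorsion W 2 | ∀ σ ∈ κ.layerSubgroup j, σ • m = m} ≤ 2 ^ t :=
  fun _ hκ ↦ natCard_fixedBy_layerSubgroup_le_pow_of_goodPrime_sq_card W hκ j ℓ h3 hgood hℓ1 hn hndvd

end Rat

end Summit.BirchSwinnertonDyer.BirchSwinnertonDyer.Theorems.TowerLayer

/-! ## §4 The torsion-tolerant TOWER-gap doors at a pair `(j, j')` with `2^{j+3} ∣ ℓ² − 1` -/

namespace Summit.BirchSwinnertonDyer.BirchSwinnertonDyer.Theorems.TowerClass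

open Summit.BirchSwinnertonDyer.Rank1Residual.X5.O1 Summit.BirchSwinnertonDyer.BirchSwinnertonDyer.Theorems

variable (W : WeierstrassCurve ℚ) [W.IsElliptic] [W.IsGloballyMinimal]

/-- **Gap from `(j, j')` counts with rational `2`-torsion, STRICT (Selmer) lower count at layer `j`, torsion
certificate at any `ℓ` with `2^{j+3} ∣ ℓ² − 1`**: PRINT `hB` + CERT {`2^a ≤ #Sel_{2^∞}(E/ℚ_j)[2]`,
`#A_{j'}[2] ≤ 2^d`, `ℓ ≥ 3` good, `2^{j+3} ∣ ℓ² − 1`, `#Ẽ(𝔽_ℓ) = n`, `¬ 2^{t+1} ∣ n`,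
`d + t + 1 ≤ 2^{j'} − 2^j + a`} ⇒ `O1.TowerGapAtTwo W`.
[cite: GreenbergLNM1716, §1 p. 60 and p. 62, §3 pp. 85–86, §4 Lemma 4.3] [cite: SilvermanAEC2009, VII.3 Prop. 3.1(b)]
[cite: Washington1997, §13.1] -/
theorem towerGapAtTwo_of_counts_of_goodPrime_sq_card_layer
    (hB : Greenberg1999.finite_torsion_cyclotomicZpExtension) {j j' a d t n : ℕ} (hjj' : j ≤ j')
    (ℓ : ℕ) [Fact ℓ.Prime] (h3 : 3 ≤ ℓ) (hgood : W.HasGoodReductionAtPrime ℓ) (hℓ1 : 2 ^ (j + 3) ∣ ℓ ^ 2 - 1)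
    (hn : W.reductionPointCount ℓ = n) (hndvd : ¬ 2 ^ (t + 1) ∣ n)
    (hlow : ∀ κ : ZpExtension ℚ 2, κ.IsCyclotomic →
      2 ^ a ≤ Nat.card {z : W.selmerLayer κ j // 2 • z = 0})
    (hup : ∀ κ : ZpExtension ℚ 2, κ.IsCyclotomic →
      Nat.card {z : W.selmerInftyPreimage κ j' // 2 • z = 0} ≤ 2 ^ d)
    (had : d + t + 1 ≤ 2 ^ j' - 2 ^ j + a) : TowerGapAtTwo W :=
  towerGapAtTwo_of_counts_of_torsion_print W hB hjj' hlow
    (TowerLayer.htor_layer_of_goodPrime_sq_card W j ℓ h3 hgood hℓ1 hn hndvd) hup had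

/-- **Gap from `(j, j')` counts with rational `2`-torsion, `A`-currency lower count at layer `j`**
(`2^a ≤ #A_j[2]`, KitE's door), torsion certificate at any `ℓ` with `2^{j+3} ∣ ℓ² − 1`.
[cite: GreenbergLNM1716, §1 p. 60 and p. 62, §3 pp. 85–86, §4 Lemma 4.3] [cite: SilvermanAEC2009, VII.3 Prop. 3.1(b)]
[cite: Washington1997, §13.1] -/
theorem towerGapAtTwo_of_classCounts_of_goodPrime_sq_card_layer
    (hB : Greenberg1999.finite_torsion_cyclotomicZpExtension) {j j' a d t n : ℕ} (hjj' : j ≤ j')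
    (ℓ : ℕ) [Fact ℓ.Prime] (h3 : 3 ≤ ℓ) (hgood : W.HasGoodReductionAtPrime ℓ) (hℓ1 : 2 ^ (j + 3) ∣ ℓ ^ 2 - 1)
    (hn : W.reductionPointCount ℓ = n) (hndvd : ¬ 2 ^ (t + 1) ∣ n)
    (hlow : ∀ κ : ZpExtension ℚ 2, κ.IsCyclotomic →
      2 ^ a ≤ Nat.card {z : W.selmerInftyPreimage κ j // 2 • z = 0})
    (hup : ∀ κ : ZpExtension ℚ 2, κ.IsCyclotomic →
      Nat.card {z : W.selmerInftyPreimage κ j' // 2 • z = 0} ≤ 2 ^ d)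
    (had : d + t + 1 ≤ 2 ^ j' - 2 ^ j + a) : TowerGapAtTwo W :=
  towerGapAtTwo_of_classCounts_of_torsion W (fun κ hκ ↦ hB W 2 κ hκ) hjj' hlow
    (TowerLayer.htor_layer_of_goodPrime_sq_card W j ℓ h3 hgood hℓ1 hn hndvd) hup had

end Summit.BirchSwinnertonDyer.BirchSwinnertonDyer.Theorems.TowerClass

end
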